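import Mathlib
import HarnessLib
import Summits.HubbardSuperconductivity.HubbardSuperconductivity.Theorems.KLProgrammeSWaveCascadeAlgebra

/-!
# Route `KLProgramme` — the s-wave-dressed Cooper cascade in the weighted max-entry algebra is STABLE for a repulsive
# s-wave coupling ((E2-v2) at every step ⇒ (B1-v2): child 1's Cooper clause, v2 design)

Cell gate-hubbard-kl, seat p3 (Cooper-channel flow).  Abstract carrier: a finite index set `S` (sector sites / lattice
momenta of a scale ball) with weights `w ≥ 0`, `W = Σ w > 0`; arrays `A : S → S → ℂ`; the weighted product
`(A ∗_w B)(s,t) = Σ_u A(s,u) w_u B(u,t)`; the all-ones array `J` (s-wave, `J ∗_w J = W·J`); the max-entry size `esup A = max |A(s,t)|`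
(p1's `|||A||| = W · esup A`).  The engine's one-step Cooper identity in IMPLICIT (resolvent) cascade form — equivalent to
`𝒞' = 𝒞 (1 + b·diag(w)·𝒞)⁻¹ + T` whenever the inverse exists, but inverse-free —

  `𝒞_{n+1} = 𝒞_n - b_n · 𝒞_{n+1} ∗_w 𝒞_n + T_n`        (`b_n ≥ 0` the shell bubble mass, `T_n` the tail: KL source + remainder)

is decomposed along `𝒞_n = U_n·J + 𝒟_n` with the EXACT scalar cascade `U_{n+1} = U_n / (1 + b_n W U_n)` of the s-wave coupling
(`U_0 ≥ 0`: REPULSIVE).  Writing `P_L X = W⁻¹ J ∗_w X` (weighted column average), `P_R X = W⁻¹ X ∗_w J` (weighted row average) —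
commuting idempotent averaging operators — the non-s-wave part obeys

  `𝒟_{n+1} + α P_R 𝒟_{n+1} = 𝒟_n - α' P_L 𝒟_n + E_n`,  `α = b_n W U_n ≥ 0`, `α' = b_n W U_{n+1} ∈ [0,1)`, `E_n = T_n - b_n 𝒟_{n+1} ∗_w 𝒟_n`,

so its four blocks `P_LP_R`, `P_LQ_R`, `Q_LP_R`, `Q_LQ_R` are multiplied by `(1-α')/(1+α)`, `(1-α')`, `1/(1+α)`, `1` — ALL IN `[0,1]`
BECAUSE `U ≥ 0` (the sign lever: for an attractive s-wave coupling the same factors exceed `1`, the BCS pole) — plus the blocks of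
`E_n`.  Hence the block size `N(𝒟) = Σ_blocks esup` (`esup ≤ N ≤ 9·esup`) satisfies `N(𝒟_{n+1}) ≤ N(𝒟_n) + 9(esup T_n + b_n W esup 𝒟_{n+1} esup 𝒟_n)`
and a discrete Gronwall argument with `Σ b_n` times the sizes small (the regime's `c ≤ c₀`) gives **`sWaveCascade_envelope`**:
`esup 𝒟_n ≤ 2·(9 esup 𝒟_0 + 9 Σ_{j<n} esup T_j)` for all `n ≤ N`, with `0 ≤ U_n ≤ U_0` — NO loss in `1/U` (a one-step triangle
inequality would lose `Π(1 + 2 b_n W U_n) ≍ (1 + U W Σ b)²`).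

Everything is elementary (finite sums); the vocabulary (`wmul`, `onesArr`, `esup`, `projL`, `projR`, the blocks, `blockSize`) is
`KLProgrammeSWaveCascadeDefs.lean`, the algebra `KLProgrammeSWaveCascadeAlgebra.lean`; this file: §3 `esup_le_of_step`,
**`blockSize_step`** (the block contraction), **`step_decompose`**; §4 `sWave_nonneg/_succ_le/_le_init/_relation/_alpha_succ_le_one`,
**`implicit_gronwall`**, **`sWaveCascade_envelope`**.  References: HOME/STATUS 2026-08-26 p1 g5 09:21:49Z ((B1-v2)/(E2-v2) design), plan g9 09:40:02Z (C-vi),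
p3 10:21:56Z (row 0′); C2 files `KLProgrammeCooperChannelRiccatiFlow*.lean` (the operator/block version of the same flow).
-/

noncomputable section

namespace Summit.HubbardSuperconductivity.HubbardSuperconductivity.Theorems.SWaveCascade

set_option linter.dupNamespace false -- summit = problem name (single-conjunct summit), D-0017

open Finset

variable {S : Type*} [Fintype S]

/-! ## §3 One step: the four blocks do not grow (the sign lever), up to the tail -/

section Step

variable {w : S → ℝ}

/-- From `(1 + α) X' = (1 - α') X + E` with `α ≥ 0`, `0 ≤ α' ≤ 1`: `esup X' ≤ esup X + esup E`. -/
theorem esup_le_of_step {X X' E : S → S → ℂ} {α α' : ℝ} (hα : 0 ≤ α) (hα'0 : 0 ≤ α') (hα'1 : α' ≤ 1)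
    (h : ((1 + α : ℝ) : ℂ) • X' = ((1 - α' : ℝ) : ℂ) • X + E) : esup X' ≤ esup X + esup E := by
  have h1 : (0 : ℝ) < 1 + α := by linarith
  have h1' : (((1 + α : ℝ)) : ℂ) ≠ 0 := by exact_mod_cast h1.ne'
  have hX' : X' = (((1 + α : ℝ) : ℂ))⁻¹ • (((1 - α' : ℝ) : ℂ) • X + E) := by
    rw [← h, smul_smul, inv_mul_cancel₀ h1', one_smul]
  rw [hX']
  refine (esup_smul_le _ _).trans ?_
  rw [norm_inv, Complex.norm_real, Real.norm_eq_abs, abs_of_pos h1]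
  have hsum := esup_add_le (((1 - α' : ℝ) : ℂ) • X) E
  have hsm : esup (((1 - α' : ℝ) : ℂ) • X) ≤ esup X := by
    refine (esup_smul_le _ _).trans ?_
    rw [Complex.norm_real, Real.norm_eq_abs, abs_of_nonneg (by linarith)]
    exact mul_le_of_le_one_left (esup_nonneg X) (by linarith)
  have hpos : 0 ≤ esup X + esup E := add_nonneg (esup_nonneg X) (esup_nonneg E)
  calc (1 + α)⁻¹ * esup (((1 - α' : ℝ) : ℂ) • X + E) ≤ (1 + α)⁻¹ * (esup X + esup E) := by
        gcongr; exact hsum.trans (add_le_add hsm le_rfl)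
    _ ≤ 1 * (esup X + esup E) := by
        gcongr; exact inv_le_one_of_one_le₀ (by linarith)
    _ = esup X + esup E := one_mul _

/-- **The block contraction.**  If `𝒟' + α P_R 𝒟' = 𝒟 - α' P_L 𝒟 + E` with `α ≥ 0` and `0 ≤ α' ≤ 1` (the repulsive
s-wave dressing: `α = bWU_{n}`, `α' = bWU_{n+1}`), then `N(𝒟') ≤ N(𝒟) + N(E)`: the blocks `PP, PQ, QP, QQ` of `𝒟'` are those of
`𝒟` times `(1-α')/(1+α), (1-α'), 1/(1+α), 1` plus the blocks of `E`. -/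
theorem blockSize_step (hW : 0 < ∑ u, w u) {𝒟 𝒟' E : S → S → ℂ} {α α' : ℝ} (hα : 0 ≤ α) (hα'0 : 0 ≤ α')
    (hα'1 : α' ≤ 1) (h : 𝒟' + (α : ℂ) • projR w 𝒟' = 𝒟 - (α' : ℂ) • projL w 𝒟 + E) :
    blockSize w 𝒟' ≤ blockSize w 𝒟 + blockSize w E := by
  have hW0 : (∑ u, w u) ≠ 0 := hW.ne'
  -- the four block identities
  have hPP : ((1 + α : ℝ) : ℂ) • blockPP w 𝒟' = ((1 - α' : ℝ) : ℂ) • blockPP w 𝒟 + blockPP w E := by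
    have := congrArg (blockPP w) h
    rw [blockPP_add, blockPP_smul, blockPP_projR hW0, blockPP_add, blockPP_sub, blockPP_smul, blockPP_projL hW0] at this
    rw [Complex.ofReal_add, Complex.ofReal_sub, Complex.ofReal_one, add_smul, one_smul, sub_smul, one_smul]
    exact this
  have hPQ : ((1 + 0 : ℝ) : ℂ) • blockPQ w 𝒟' = ((1 - α' : ℝ) : ℂ) • blockPQ w 𝒟 + blockPQ w E := by
    have := congrArg (blockPQ w) h
    rw [blockPQ_add, blockPQ_smul, blockPQ_projR hW0, smul_zero, add_zero, blockPQ_add, blockPQ_sub, blockPQ_smul,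
      blockPQ_projL hW0] at this
    rw [add_zero, Complex.ofReal_one, one_smul, Complex.ofReal_sub, Complex.ofReal_one, sub_smul, one_smul]
    exact this
  have hQP : ((1 + α : ℝ) : ℂ) • blockQP w 𝒟' = ((1 - 0 : ℝ) : ℂ) • blockQP w 𝒟 + blockQP w E := by
    have := congrArg (blockQP w) h
    rw [blockQP_add, blockQP_smul, blockQP_projR hW0, blockQP_add, blockQP_sub, blockQP_smul, blockQP_projL hW0,
      smul_zero, sub_zero] at this
    rw [Complex.ofReal_add, Complex.ofReal_one, add_smul, one_smul, sub_zero, Complex.ofReal_one, one_smul]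
    exact this
  have hQQ : ((1 + 0 : ℝ) : ℂ) • blockQQ w 𝒟' = ((1 - 0 : ℝ) : ℂ) • blockQQ w 𝒟 + blockQQ w E := by
    have := congrArg (blockQQ w) h
    rw [blockQQ_add, blockQQ_smul, blockQQ_projR hW0, smul_zero, add_zero, blockQQ_add, blockQQ_sub, blockQQ_smul,
      blockQQ_projL hW0, smul_zero, sub_zero] at this
    rw [add_zero, sub_zero, Complex.ofReal_one, one_smul, one_smul]
    exact this
  have h1 := esup_le_of_step hα hα'0 hα'1 hPP
  have h2 := esup_le_of_step le_rfl hα'0 hα'1 hPQ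
  have h3 := esup_le_of_step hα le_rfl zero_le_one hQP
  have h4 := esup_le_of_step le_rfl le_rfl zero_le_one hQQ
  unfold blockSize
  linarith

/-- **The decomposition of one cascade step along `U·J + 𝒟`.**  If `𝒞' = 𝒞 - b · 𝒞' ∗_w 𝒞 + T` and the scalars satisfy
the s-wave cascade relation `U' (1 + b W U) = U`, then with `𝒟 = 𝒞 - U J`, `𝒟' = 𝒞' - U' J`:
`𝒟' + (bWU) P_R 𝒟' = 𝒟 - (bWU') P_L 𝒟 + (T - b 𝒟' ∗_w 𝒟)`. -/
theorem step_decompose (hW : (∑ u, w u) ≠ 0) {𝒞 𝒞' T 𝒟 𝒟' : S → S → ℂ} {b U U' : ℝ}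
    (hstep : 𝒞' = 𝒞 - (b : ℂ) • wmul w 𝒞' 𝒞 + T) (hU : U' * (1 + b * (∑ u, w u) * U) = U)
    (h𝒟 : 𝒟 = 𝒞 - (U : ℂ) • onesArr) (h𝒟' : 𝒟' = 𝒞' - (U' : ℂ) • onesArr) :
    𝒟' + ((b * (∑ u, w u) * U : ℝ) : ℂ) • projR w 𝒟' =
      𝒟 - ((b * (∑ u, w u) * U' : ℝ) : ℂ) • projL w 𝒟 + (T - (b : ℂ) • wmul w 𝒟' 𝒟) := by
  have h𝒞 : 𝒞 = (U : ℂ) • onesArr + 𝒟 := by rw [h𝒟]; abel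
  have h𝒞' : 𝒞' = (U' : ℂ) • onesArr + 𝒟' := by rw [h𝒟']; abel
  -- expand the product
  have hprod : wmul w 𝒞' 𝒞 = ((U' : ℂ) * (U : ℂ) * (((∑ u, w u : ℝ)) : ℂ)) • onesArr +
      ((U' : ℂ) * (((∑ u, w u : ℝ)) : ℂ)) • projL w 𝒟 + ((U : ℂ) * (((∑ u, w u : ℝ)) : ℂ)) • projR w 𝒟' + wmul w 𝒟' 𝒟 := by
    rw [h𝒞, h𝒞', wmul_add_left, wmul_add_right, wmul_add_right, wmul_smul_left, wmul_smul_left, wmul_smul_right,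
      wmul_smul_right, wmul_onesArr_onesArr, wmul_onesArr_left w hW, wmul_onesArr_right w hW]
    simp only [smul_smul]
    have e1 : (U' : ℂ) * ((U : ℂ) * (((∑ u, w u : ℝ)) : ℂ)) = (U' : ℂ) * (U : ℂ) * (((∑ u, w u : ℝ)) : ℂ) := by ring
    rw [e1]
    abel
  -- pointwise
  funext s t
  have hpt := congrFun (congrFun hstep s) t
  have hpr := congrFun (congrFun hprod s) t
  have e𝒟 : 𝒟 s t = 𝒞 s t - (U : ℂ) := by rw [h𝒟]; simp [onesArr]
  have e𝒟' : 𝒟' s t = 𝒞' s t - (U' : ℂ) := by rw [h𝒟']; simp [onesArr]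
  simp only [Pi.add_apply, Pi.sub_apply, Pi.smul_apply, smul_eq_mul, onesArr, mul_one] at hpt hpr ⊢
  rw [hpr] at hpt
  have hUc : (U' : ℂ) * (1 + (b : ℂ) * (((∑ u, w u : ℝ)) : ℂ) * (U : ℂ)) = (U : ℂ) := by exact_mod_cast hU
  push_cast at hpt hUc ⊢
  linear_combination hpt - hUc + e𝒟' - e𝒟

end Step


/-! ## §4 The scalar s-wave cascade, the implicit Gronwall lemma, and the envelope -/

section Scalar

variable {U b : ℕ → ℝ} {W : ℝ}

/-- The repulsive scalar cascade `U_{n+1} = U_n/(1 + b_n W U_n)` stays nonnegative. -/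
theorem sWave_nonneg (hW : 0 ≤ W) (hb : ∀ n, 0 ≤ b n) (h0 : 0 ≤ U 0)
    (hU : ∀ n, U (n + 1) = U n / (1 + b n * W * U n)) : ∀ n, 0 ≤ U n := by
  intro n
  induction n with
  | zero => exact h0
  | succ n ih =>
    rw [hU n]
    exact div_nonneg ih (by have := mul_nonneg (mul_nonneg (hb n) hW) ih; linarith)

/-- … is non-increasing. -/
theorem sWave_succ_le (hW : 0 ≤ W) (hb : ∀ n, 0 ≤ b n) (h0 : 0 ≤ U 0)
    (hU : ∀ n, U (n + 1) = U n / (1 + b n * W * U n)) (n : ℕ) : U (n + 1) ≤ U n := by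
  have hn := sWave_nonneg hW hb h0 hU n
  rw [hU n]
  exact div_le_self hn (by have := mul_nonneg (mul_nonneg (hb n) hW) hn; linarith)

/-- … hence below its initial value. -/
theorem sWave_le_init (hW : 0 ≤ W) (hb : ∀ n, 0 ≤ b n) (h0 : 0 ≤ U 0)
    (hU : ∀ n, U (n + 1) = U n / (1 + b n * W * U n)) : ∀ n, U n ≤ U 0 := by
  intro n
  induction n with
  | zero => exact le_rfl
  | succ n ih => exact (sWave_succ_le hW hb h0 hU n).trans ih

/-- The cascade relation `U_{n+1} (1 + b_n W U_n) = U_n`. -/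
theorem sWave_relation (hW : 0 ≤ W) (hb : ∀ n, 0 ≤ b n) (h0 : 0 ≤ U 0)
    (hU : ∀ n, U (n + 1) = U n / (1 + b n * W * U n)) (n : ℕ) : U (n + 1) * (1 + b n * W * U n) = U n := by
  have hn := sWave_nonneg hW hb h0 hU n
  have hpos : 0 < 1 + b n * W * U n := by have := mul_nonneg (mul_nonneg (hb n) hW) hn; linarith
  rw [hU n, div_mul_cancel₀ _ hpos.ne']

/-- The dressed mass after the step is at most one: `b_n W U_{n+1} = x/(1+x) ≤ 1`, `x = b_n W U_n ≥ 0`. -/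
theorem sWave_alpha_succ_le_one (hW : 0 ≤ W) (hb : ∀ n, 0 ≤ b n) (h0 : 0 ≤ U 0)
    (hU : ∀ n, U (n + 1) = U n / (1 + b n * W * U n)) (n : ℕ) : b n * W * U (n + 1) ≤ 1 := by
  have hn := sWave_nonneg hW hb h0 hU n
  have hx : 0 ≤ b n * W * U n := mul_nonneg (mul_nonneg (hb n) hW) hn
  have hpos : 0 < 1 + b n * W * U n := by linarith
  rw [hU n, ← mul_div_assoc, div_le_one hpos]
  linarith

end Scalar

/-- **Implicit discrete Gronwall lemma.**  Nonnegative `d, t, b` with `d_{n+1} (1 - K b_n d_n) ≤ d_n + t_n` (`n < N`, `K ≥ 0`)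
and the smallness `8 K (d_0 + Σ_{j<N} t_j) Σ_{j<N} b_j ≤ 1` satisfy `d_n ≤ 2 (d_0 + Σ_{j<N} t_j)` for all `n ≤ N`. -/
theorem implicit_gronwall {d t b : ℕ → ℝ} {K : ℝ} {N : ℕ} (hK : 0 ≤ K) (hd : ∀ n, 0 ≤ d n) (ht : ∀ n, 0 ≤ t n)
    (hb : ∀ n, 0 ≤ b n) (hstep : ∀ n < N, d (n + 1) * (1 - K * b n * d n) ≤ d n + t n)
    (hsmall : 8 * K * (d 0 + ∑ j ∈ range N, t j) * ∑ j ∈ range N, b j ≤ 1) :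
    ∀ n ≤ N, d n ≤ 2 * (d 0 + ∑ j ∈ range N, t j) := by
  set A : ℝ := d 0 + ∑ j ∈ range N, t j with hA_def
  have hA : 0 ≤ A := add_nonneg (hd 0) (sum_nonneg fun j _ => ht j)
  -- partial sums
  set An : ℕ → ℝ := fun n => d 0 + ∑ j ∈ range n, t j with hAn_def
  set σ : ℕ → ℝ := fun n => 4 * K * A * ∑ j ∈ range n, b j with hσ_def
  have hAn_le : ∀ n ≤ N, An n ≤ A := fun n hn =>
    add_le_add le_rfl (sum_le_sum_of_subset_of_nonneg (range_mono hn) fun j _ _ => ht j)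
  have hAn_nonneg : ∀ n, 0 ≤ An n := fun n => add_nonneg (hd 0) (sum_nonneg fun j _ => ht j)
  have hσ_le : ∀ n ≤ N, σ n ≤ 1 / 2 := fun n hn => by
    have h1 : ∑ j ∈ range n, b j ≤ ∑ j ∈ range N, b j :=
      sum_le_sum_of_subset_of_nonneg (range_mono hn) fun j _ _ => hb j
    have h2 : σ n ≤ 4 * K * A * ∑ j ∈ range N, b j := mul_le_mul_of_nonneg_left h1 (by positivity)
    linarith
  have hσ_nonneg : ∀ n, 0 ≤ σ n := fun n => by
    have : 0 ≤ ∑ j ∈ range n, b j := sum_nonneg fun j _ => hb j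
    simp only [hσ_def]; positivity
  have hσ_succ : ∀ n, σ (n + 1) = σ n + 4 * K * A * b n := fun n => by
    simp only [hσ_def, sum_range_succ]; ring
  have hAn_succ : ∀ n, An (n + 1) = An n + t n := fun n => by
    simp only [hAn_def, sum_range_succ]; ring
  -- the induction
  have key : ∀ n ≤ N, d n ≤ An n / (1 - σ n) := by
    intro n
    induction n with
    | zero => intro; simp [hAn_def, hσ_def]
    | succ n ih =>
      intro hn
      have hn' : n < N := Nat.lt_of_succ_le hn
      have ihn := ih hn'.le
      have hσn := hσ_le n hn'.le
      have hσn1 := hσ_le (n + 1) hn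
      have h1σ : 0 < 1 - σ n := by linarith
      -- a-priori bound `d n ≤ 2A`
      have hdn : d n ≤ 2 * A := by
        calc d n ≤ An n / (1 - σ n) := ihn
          _ ≤ A / (1 / 2) := div_le_div₀ hA (hAn_le n hn'.le) (by norm_num) (by linarith)
          _ = 2 * A := by ring
      set y : ℝ := K * b n * d n with hy
      have hy0 : 0 ≤ y := mul_nonneg (mul_nonneg hK (hb n)) (hd n)
      have hσn0 := hσ_nonneg n
      have hy2 : 2 * y ≤ σ (n + 1) - σ n := by
        rw [hσ_succ, hy]
        have : K * b n * d n ≤ K * b n * (2 * A) := mul_le_mul_of_nonneg_left hdn (mul_nonneg hK (hb n))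
        linarith
      have h1y : 0 < 1 - y := by linarith
      have hst := hstep n hn'
      rw [← hy] at hst
      -- d (n+1) ≤ (d n + t n)/(1 - y) ≤ (An (n+1)/(1-σ n))/(1-y) ≤ An (n+1)/(1 - σ (n+1))
      have hd1 : d (n + 1) ≤ (d n + t n) / (1 - y) := by rw [le_div_iff₀ h1y]; exact hst
      have hnum : d n + t n ≤ An (n + 1) / (1 - σ n) := by
        rw [hAn_succ, add_div]
        exact add_le_add ihn (le_div_self (ht n) h1σ (by linarith))
      have hden : 1 - σ (n + 1) ≤ (1 - σ n) * (1 - y) := by nlinarith [mul_nonneg hσn0 hy0, hy2, hy0]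
      have h1σ1 : 0 < 1 - σ (n + 1) := by linarith
      calc d (n + 1) ≤ (d n + t n) / (1 - y) := hd1
        _ ≤ (An (n + 1) / (1 - σ n)) / (1 - y) := div_le_div_of_nonneg_right hnum h1y.le
        _ = An (n + 1) / ((1 - σ n) * (1 - y)) := by rw [div_div]
        _ ≤ An (n + 1) / (1 - σ (n + 1)) := div_le_div_of_nonneg_left (hAn_nonneg _) h1σ1 hden
  intro n hn
  have hσn := hσ_le n hn
  calc d n ≤ An n / (1 - σ n) := key n hn
    _ ≤ A / (1 / 2) := div_le_div₀ hA (hAn_le n hn) (by norm_num) (by linarith)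
    _ = 2 * A := by ring

/-- **The envelope of the s-wave-dressed cascade ((E2-v2) at every step ⇒ (B1-v2)).**  Weights `w ≥ 0` with `W = Σ w > 0`;
masses `b_n ≥ 0`; a repulsive initial s-wave coupling `U_0 ≥ 0` and its EXACT scalar cascade `U_{n+1} = U_n/(1 + b_n W U_n)`;
arrays `𝒞_n` obeying the implicit cascade steps `𝒞_{n+1} = 𝒞_n - b_n 𝒞_{n+1} ∗_w 𝒞_n + T_n` for `n < N`; and the smallness
`8·9W·(9·esup 𝒟_0 + 9·Σ_{j<N} esup T_j)·Σ_{j<N} b_j ≤ 1` (`𝒟_n := 𝒞_n - U_n J`; in the KL regime `Σ b ≍ c/U²` and the sizes are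
`O(U²)`, so this is the regime's `c ≤ c₀`).  THEN for every `n ≤ N`: `0 ≤ U_n ≤ U_0` and
`esup (𝒞_n - U_n J) ≤ 2·(9·esup (𝒞_0 - U_0 J) + 9·Σ_{j<N} esup T_j)` — uniformly, with no loss in `1/U`. -/
theorem sWaveCascade_envelope {w : S → ℝ} (hw : ∀ u, 0 ≤ w u) (hW : 0 < ∑ u, w u) {𝒞 T : ℕ → S → S → ℂ}
    {b U : ℕ → ℝ} {N : ℕ} (hb : ∀ n, 0 ≤ b n) (hU0 : 0 ≤ U 0)
    (hU : ∀ n, U (n + 1) = U n / (1 + b n * (∑ u, w u) * U n))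
    (hstep : ∀ n < N, 𝒞 (n + 1) = 𝒞 n - ((b n : ℝ) : ℂ) • wmul w (𝒞 (n + 1)) (𝒞 n) + T n)
    (hsmall : 8 * (9 * ∑ u, w u) * (9 * esup (𝒞 0 - ((U 0 : ℝ) : ℂ) • onesArr) + ∑ j ∈ range N, 9 * esup (T j)) *
      ∑ j ∈ range N, b j ≤ 1) :
    ∀ n ≤ N, (0 ≤ U n ∧ U n ≤ U 0) ∧
      esup (𝒞 n - ((U n : ℝ) : ℂ) • onesArr) ≤
        2 * (9 * esup (𝒞 0 - ((U 0 : ℝ) : ℂ) • onesArr) + ∑ j ∈ range N, 9 * esup (T j)) := by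
  set W : ℝ := ∑ u, w u with hWdef
  have hW0 : 0 ≤ W := hW.le
  set 𝒟 : ℕ → S → S → ℂ := fun n => 𝒞 n - ((U n : ℝ) : ℂ) • onesArr with h𝒟
  set d : ℕ → ℝ := fun n => blockSize w (𝒟 n) with hd
  have hUn := sWave_nonneg hW0 hb hU0 hU
  have hd_nonneg : ∀ n, 0 ≤ d n := fun n => blockSize_nonneg w _
  have hed : ∀ n, esup (𝒟 n) ≤ d n := fun n => esup_le_blockSize w _
  have hde : ∀ n, d n ≤ 9 * esup (𝒟 n) := fun n => blockSize_le hw hW _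
  -- the one-step inequality
  have hstep' : ∀ n < N, d (n + 1) * (1 - 9 * W * b n * d n) ≤ d n + 9 * esup (T n) := by
    intro n hn
    have hrel := sWave_relation hW0 hb hU0 hU n
    have hdec := step_decompose (w := w) hW.ne' (hstep n hn) hrel rfl rfl
    have hα : 0 ≤ b n * W * U n := mul_nonneg (mul_nonneg (hb n) hW0) (hUn n)
    have hα'0 : 0 ≤ b n * W * U (n + 1) := mul_nonneg (mul_nonneg (hb n) hW0) (hUn (n + 1))
    have hα'1 := sWave_alpha_succ_le_one hW0 hb hU0 hU n
    have hblk := blockSize_step hW hα hα'0 hα'1 hdec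
    -- the tail block size
    have hE : blockSize w (T n - ((b n : ℝ) : ℂ) • wmul w (𝒟 (n + 1)) (𝒟 n)) ≤
        9 * esup (T n) + 9 * W * b n * d (n + 1) * d n := by
      refine (blockSize_le hw hW _).trans ?_
      have h1 := esup_sub_le (T n) (((b n : ℝ) : ℂ) • wmul w (𝒟 (n + 1)) (𝒟 n))
      have h2 := esup_smul_le ((b n : ℝ) : ℂ) (wmul w (𝒟 (n + 1)) (𝒟 n))
      rw [Complex.norm_real, Real.norm_eq_abs, abs_of_nonneg (hb n)] at h2
      have h3 := esup_wmul_le w hw (𝒟 (n + 1)) (𝒟 n)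
      have h4 : esup (𝒟 (n + 1)) * W * esup (𝒟 n) ≤ d (n + 1) * W * d n :=
        mul_le_mul (mul_le_mul_of_nonneg_right (hed _) hW0) (hed _) (esup_nonneg _)
          (mul_nonneg (hd_nonneg _) hW0)
      have h5 : b n * esup (wmul w (𝒟 (n + 1)) (𝒟 n)) ≤ b n * (d (n + 1) * W * d n) :=
        mul_le_mul_of_nonneg_left (h3.trans h4) (hb n)
      nlinarith
    have : d (n + 1) ≤ d n + (9 * esup (T n) + 9 * W * b n * d (n + 1) * d n) := hblk.trans (add_le_add le_rfl hE)
    nlinarith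
  -- Gronwall
  have hK : (0 : ℝ) ≤ 9 * W := by positivity
  have hsmall' : 8 * (9 * W) * (d 0 + ∑ j ∈ range N, 9 * esup (T j)) * ∑ j ∈ range N, b j ≤ 1 := by
    refine le_trans ?_ hsmall
    have hB : 0 ≤ ∑ j ∈ range N, b j := sum_nonneg fun j _ => hb j
    have : d 0 + ∑ j ∈ range N, 9 * esup (T j) ≤ 9 * esup (𝒟 0) + ∑ j ∈ range N, 9 * esup (T j) :=
      add_le_add (hde 0) le_rfl
    exact mul_le_mul_of_nonneg_right (mul_le_mul_of_nonneg_left this (by positivity)) hB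
  have hG := implicit_gronwall (d := d) (t := fun n => 9 * esup (T n)) (b := b) hK hd_nonneg
    (fun n => mul_nonneg (by norm_num) (esup_nonneg _)) hb
    (fun n hn => by simpa [mul_assoc, mul_comm, mul_left_comm] using hstep' n hn) hsmall'
  intro n hn
  refine ⟨⟨hUn n, sWave_le_init hW0 hb hU0 hU n⟩, ?_⟩
  calc esup (𝒟 n) ≤ d n := hed n
    _ ≤ 2 * (d 0 + ∑ j ∈ range N, 9 * esup (T j)) := hG n hn
    _ ≤ 2 * (9 * esup (𝒟 0) + ∑ j ∈ range N, 9 * esup (T j)) := by linarith [hde 0]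


end Summit.HubbardSuperconductivity.HubbardSuperconductivity.Theorems.SWaveCascade

end
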